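import Summits.CriticalPhenomena.PercolationContinuityZ3.Theorems.SahiAEPlaneZeros
import Summits.CriticalPhenomena.PercolationContinuityZ3.Theorems.SahiAEVersionTransportAtoms

/-!
# The planar structure theorem for densities with zeros: product reference measures WITH ATOMS

Support file of the Sahi cell (`prim-sahi`, typer seat, generation 24; `--supports stmt-CriticalPhenomena-4575`).
Theorems only (no definitions, no named facts, no sorries).

`SahiAEPlaneZerosPi.lean` treats products of atomless reference measures by the (then a.e. invertible) quantile
transport.  With atoms the quantile map collapses the jump intervals; as in `SahiAEVersionTransportAtoms.lean`
(generation 21, positive bounded densities) the version is DESCENDED from the square by an essential supremum over the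
randomized probability integral transform, `F(x) = ess sup_v F'(θ_x(v))`, where `F'` is now the Borel everywhere-TP₂
version of `𝟙_{(0,1)²} · (f ∘ T)` given by the planar zeros theorem (`SahiAEPlaneZeros.lean`).  The lattice and
measurability arguments are those of generation 21 verbatim (`rpit_pi_inf/sup`, `volume_prod_piecewise_mem_null`,
Fubini for the level sets); only boundedness is gone, so the descended version is finite almost everywhere (it is a
version of the a.e. finite `f`) rather than everywhere.

* `Plane.exists_measurable_tp2_version_of_ae_zeros_pi_prob` — products of two probability measures on `ℝ`;
* `Plane.exists_measurable_tp2_version_of_ae_zeros_pi'` — products of two σ-finite measures on `ℝ`, atoms allowed: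
  every measurable, a.e. finite density TP₂ on almost every pair has a Borel version TP₂ at EVERY pair of `ℝ²`.

No sorries, no new axioms.
-/

noncomputable section

namespace Summit.CriticalPhenomena.PercolationContinuityZ3.Theorems.SahiAEFourFunctions

namespace Plane

open MeasureTheory Set Filter Topology Function ProbabilityTheory RealQuantile
open scoped ENNReal NNReal

/-- **Densities with zeros, product of probability measures with atoms.**  For probability measures `ν₀, ν₁` on `ℝ`
(atoms allowed) and `π = ν₀ ⊗ ν₁`: every measurable, `π`-a.e. finite `f : ℝ² → [0,∞]`, TP₂ on `π ⊗ π`-almost every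
pair, has a Borel version `F = f` `π`-a.e. with `F(x) F(y) ≤ F(x ∧ y) F(x ∨ y)` for ALL `x, y`. [this work] -/
theorem exists_measurable_tp2_version_of_ae_zeros_pi_prob (ν : Fin 2 → Measure ℝ) [∀ i, IsProbabilityMeasure (ν i)]
    (f : (Fin 2 → ℝ) → ℝ≥0∞) (hf : Measurable f) (hfin : ∀ᵐ x ∂Measure.pi ν, f x ≠ ∞)
    (hMTP : ∀ᵐ p ∂(Measure.pi ν).prod (Measure.pi ν), f p.1 * f p.2 ≤ f (p.1 ⊓ p.2) * f (p.1 ⊔ p.2)) :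
    ∃ F : (Fin 2 → ℝ) → ℝ≥0∞, Measurable F ∧ F =ᵐ[Measure.pi ν] f ∧ ∀ x y, F x * F y ≤ F (x ⊓ y) * F (x ⊔ y) := by
  classical
  set U : Set (Fin 2 → ℝ) := Set.pi univ fun _ => Ioo (0 : ℝ) 1 with hU
  have mU : MeasurableSet U := MeasurableSet.univ_pi fun _ => measurableSet_Ioo
  set μ₁ : Measure (Fin 2 → ℝ) := (volume : Measure (Fin 2 → ℝ)).restrict U with hμ₁
  have hμ₁pi : μ₁ = Measure.pi fun _ : Fin 2 => (volume : Measure ℝ).restrict (Ioo (0 : ℝ) 1) := by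
    rw [hμ₁, hU, volume_pi, Measure.restrict_pi_pi]
  have hμ₁0 : μ₁ ≠ 0 := by
    intro h
    have h1 : μ₁ U = 0 := by rw [h]; rfl
    rw [hμ₁, Measure.restrict_apply_self, hU, volume_pi_pi] at h1
    simp only [Real.volume_Ioo, sub_zero, ENNReal.ofReal_one, Finset.prod_const_one, one_ne_zero] at h1
  haveI : IsFiniteMeasure μ₁ := by
    refine ⟨?_⟩
    rw [hμ₁, Measure.restrict_apply_univ, hU, volume_pi_pi]
    simp only [Real.volume_Ioo, sub_zero, ENNReal.ofReal_one, Finset.prod_const_one, ENNReal.one_lt_top]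
  -- the quantile map and the pulled-back density
  set T : (Fin 2 → ℝ) → (Fin 2 → ℝ) := fun u i => rqe (ν i) (u i) with hT
  have hTmp : MeasurePreserving T μ₁ (Measure.pi ν) := by
    rw [hμ₁pi]; exact measurePreserving_pi _ _ fun i => measurePreserving_rqe (ν i)
  have haeU : ∀ᵐ u ∂μ₁, u ∈ U := ae_restrict_mem mU
  have haeU2 : ∀ᵐ p ∂μ₁.prod μ₁, p.1 ∈ U ∧ p.2 ∈ U := by
    filter_upwards [(Measure.quasiMeasurePreserving_fst (μ := μ₁) (ν := μ₁)).ae haeU,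
      (Measure.quasiMeasurePreserving_snd (μ := μ₁) (ν := μ₁)).ae haeU] with p h1 h2 using ⟨h1, h2⟩
  have hTlat : ∀ᵐ p ∂μ₁.prod μ₁, T (p.1 ⊓ p.2) = T p.1 ⊓ T p.2 ∧ T (p.1 ⊔ p.2) = T p.1 ⊔ T p.2 := by
    filter_upwards [haeU2] with p hp
    refine ⟨funext fun i => ?_, funext fun i => ?_⟩
    · exact (monotoneOn_rqe (ν i)).map_inf (Set.mem_univ_pi.1 hp.1 i) (Set.mem_univ_pi.1 hp.2 i)
    · exact (monotoneOn_rqe (ν i)).map_sup (Set.mem_univ_pi.1 hp.1 i) (Set.mem_univ_pi.1 hp.2 i)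
  have hqmp2 : Measure.QuasiMeasurePreserving (Prod.map T T) (μ₁.prod μ₁) ((Measure.pi ν).prod (Measure.pi ν)) :=
    MeasureTheory.QuasiMeasurePreserving.prodMap hTmp.quasiMeasurePreserving hTmp.quasiMeasurePreserving
  have hMTP' : ∀ᵐ p ∂μ₁.prod μ₁, f (T p.1) * f (T p.2) ≤ f (T (p.1 ⊓ p.2)) * f (T (p.1 ⊔ p.2)) := by
    filter_upwards [hqmp2.ae hMTP, hTlat] with p hp hl
    rw [hl.1, hl.2]; exact hp
  -- the planar zeros theorem for `𝟙_U · (f ∘ T)` (no positivity, no bounds)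
  have hUinf : ∀ x ∈ U, ∀ y ∈ U, x ⊓ y ∈ U := fun x hx y hy => Set.mem_univ_pi.2 fun i =>
    ⟨lt_min (Set.mem_univ_pi.1 hx i).1 (Set.mem_univ_pi.1 hy i).1, (min_le_left _ _).trans_lt (Set.mem_univ_pi.1 hx i).2⟩
  have hUsup : ∀ x ∈ U, ∀ y ∈ U, x ⊔ y ∈ U := fun x hx y hy => Set.mem_univ_pi.2 fun i =>
    ⟨(Set.mem_univ_pi.1 hx i).1.trans_le (le_max_left _ _), max_lt (Set.mem_univ_pi.1 hx i).2 (Set.mem_univ_pi.1 hy i).2⟩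
  set g : (Fin 2 → ℝ) → ℝ≥0∞ := U.indicator (f ∘ T) with hg
  have hgm : Measurable g := (hf.comp hTmp.measurable).indicator mU
  have hνf : ∀ᵐ u ∂μ₁, f (T u) ≠ ∞ := hTmp.quasiMeasurePreserving.ae hfin
  have hgfin : ∀ᵐ x ∂(volume : Measure (Fin 2 → ℝ)), g x ≠ ∞ := by
    have h1 := hνf
    rw [hμ₁, ae_restrict_iff' mU] at h1
    filter_upwards [h1] with x hx
    by_cases hxU : x ∈ U
    · rw [hg, Set.indicator_of_mem hxU]; exact hx hxU
    · rw [hg, Set.indicator_of_notMem hxU]; exact ENNReal.zero_ne_top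
  have hgMTP : ∀ᵐ q ∂(volume : Measure (Fin 2 → ℝ)).prod volume, g q.1 * g q.2 ≤ g (q.1 ⊓ q.2) * g (q.1 ⊔ q.2) := by
    have h1 := hMTP'
    rw [hμ₁, Measure.prod_restrict, ae_restrict_iff' (mU.prod mU)] at h1
    filter_upwards [h1] with q hq
    by_cases h1U : q.1 ∈ U
    · by_cases h2U : q.2 ∈ U
      · simp only [hg, Set.indicator_of_mem h1U, Set.indicator_of_mem h2U, Set.indicator_of_mem (hUinf _ h1U _ h2U),
          Set.indicator_of_mem (hUsup _ h1U _ h2U), Function.comp_apply]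
        exact hq ⟨h1U, h2U⟩
      · rw [hg, Set.indicator_of_notMem h2U, mul_zero]; exact zero_le
    · rw [hg, Set.indicator_of_notMem h1U, zero_mul]; exact zero_le
  obtain ⟨F', hF'm, hF'b, hF'g, hF'mtp⟩ := Plane.exists_measurable_tp2_version_of_ae_zeros g hgm hgfin hgMTP
  have hF'ae : ∀ᵐ u ∂μ₁, F' u = (f ∘ T) u := by
    rw [hμ₁, ae_restrict_iff' mU]
    filter_upwards [hF'g] with u hu huU
    rw [hu, hg, Set.indicator_of_mem huU]
  -- the transform and the descended version
  set θ : (Fin 2 → ℝ) → (Fin 2 → ℝ) → (Fin 2 → ℝ) := fun x v i => rpit (ν i) (x i) (v i) with hθ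
  have hθm : Measurable fun q : (Fin 2 → ℝ) × (Fin 2 → ℝ) => θ q.1 q.2 := by
    refine measurable_pi_iff.2 fun i => ?_
    have hq : Measurable fun q : (Fin 2 → ℝ) × (Fin 2 → ℝ) => ((q.1 i, q.2 i) : ℝ × ℝ) :=
      ((measurable_pi_apply i).comp measurable_fst).prodMk ((measurable_pi_apply i).comp measurable_snd)
    show Measurable fun q : (Fin 2 → ℝ) × (Fin 2 → ℝ) => rpit (ν i) (q.1 i) (q.2 i)
    exact (measurable_rpit (ν i)).comp hq
  have hθm' : ∀ x, Measurable (θ x) := fun x => hθm.comp (measurable_const.prodMk measurable_id)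
  set F : (Fin 2 → ℝ) → ℝ≥0∞ := fun x => essSup (fun v => F' (θ x v)) μ₁ with hF
  have hGm : Measurable fun q : (Fin 2 → ℝ) × (Fin 2 → ℝ) => F' (θ q.1 q.2) := hF'm.comp hθm
  have hFm : Measurable F := by
    refine measurable_of_Iic fun a => ?_
    have hSm : MeasurableSet {q : (Fin 2 → ℝ) × (Fin 2 → ℝ) | a < F' (θ q.1 q.2) ∧ q.2 ∈ U} :=
      (measurableSet_lt measurable_const hGm).inter (mU.preimage measurable_snd)
    have hm : Measurable fun x : Fin 2 → ℝ =>
        volume (Prod.mk x ⁻¹' {q : (Fin 2 → ℝ) × (Fin 2 → ℝ) | a < F' (θ q.1 q.2) ∧ q.2 ∈ U}) :=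
      measurable_measure_prodMk_left hSm
    have hset : F ⁻¹' Iic a = (fun x : Fin 2 → ℝ =>
        volume (Prod.mk x ⁻¹' {q : (Fin 2 → ℝ) × (Fin 2 → ℝ) | a < F' (θ q.1 q.2) ∧ q.2 ∈ U})) ⁻¹' {0} := by
      ext x
      simp only [mem_preimage, mem_Iic, mem_singleton_iff]
      have e : Prod.mk x ⁻¹' {q : (Fin 2 → ℝ) × (Fin 2 → ℝ) | a < F' (θ q.1 q.2) ∧ q.2 ∈ U} =
          {v | a < F' (θ x v)} ∩ U := rfl
      rw [e]
      exact ⟨measure_inter_eq_zero_of_essSup_restrict_le (hF'm.comp (hθm' x)),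
        essSup_restrict_le_of_measure_inter_eq_zero (hF'm.comp (hθm' x))⟩
    rw [hset]
    exact hm (measurableSet_singleton 0)
  refine ⟨F, hFm, ?_, ?_⟩
  · -- `F = f` almost everywhere
    set κ : (Fin 2 → ℝ) × (Fin 2 → ℝ) → (Fin 2 → ℝ) := fun q => θ (T q.1) q.2 with hκ
    have hκqmp : Measure.QuasiMeasurePreserving κ (μ₁.prod μ₁) μ₁ := by
      have he := (measurePreserving_arrowProdEquivProdArrow ℝ ℝ (Fin 2)
        (fun _ : Fin 2 => (volume : Measure ℝ).restrict (Ioo (0 : ℝ) 1))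
        (fun _ : Fin 2 => (volume : Measure ℝ).restrict (Ioo (0 : ℝ) 1))).symm
      rw [← hμ₁pi] at he
      have hK : Measure.QuasiMeasurePreserving
          (fun (w : Fin 2 → ℝ × ℝ) i => rpit (ν i) (rqe (ν i) (w i).1) (w i).2)
          (Measure.pi fun _ : Fin 2 => ((volume : Measure ℝ).restrict (Ioo (0 : ℝ) 1)).prod
            ((volume : Measure ℝ).restrict (Ioo (0 : ℝ) 1))) μ₁ := by
        rw [hμ₁pi]
        exact quasiMeasurePreserving_pi_map
          (k := fun i (z : ℝ × ℝ) => rpit (ν i) (rqe (ν i) z.1) z.2)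
          fun i => quasiMeasurePreserving_rpit_rqe (ν i)
      have hcomp : κ = (fun (w : Fin 2 → ℝ × ℝ) i => rpit (ν i) (rqe (ν i) (w i).1) (w i).2) ∘
          (MeasurableEquiv.arrowProdEquivProdArrow ℝ ℝ (Fin 2)).symm := by
        funext q; rfl
      rw [hcomp]
      exact hK.comp he.quasiMeasurePreserving
    have h1 : ∀ᵐ q ∂μ₁.prod μ₁, F' (κ q) = f (T (κ q)) := hκqmp.ae hF'ae
    have h2 : ∀ᵐ q ∂μ₁.prod μ₁, T (κ q) = T q.1 := by
      filter_upwards [haeU2] with q hq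
      funext i
      have hu := Set.mem_univ_pi.1 hq.1 i
      have hv := Set.mem_univ_pi.1 hq.2 i
      have h := rq_rpit_rq (ν i) hu hv
      show rqe (ν i) (rpit (ν i) (rqe (ν i) (q.1 i)) (q.2 i)) = rqe (ν i) (q.1 i)
      rw [rqe_of_mem _ hu, rqe_of_mem _ h.1, h.2]
    have h3' : ∀ᵐ q ∂μ₁.prod μ₁, F' (κ q) = f (T q.1) := by
      filter_upwards [h1, h2] with q hq1 hq2
      rw [hq2] at hq1; exact hq1
    have h3 : ∀ᵐ u ∂μ₁, ∀ᵐ v ∂μ₁, F' (θ (T u) v) = f (T u) :=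
      Measure.ae_ae_of_ae_prod (p := fun q : (Fin 2 → ℝ) × (Fin 2 → ℝ) => F' (θ (T q.1) q.2) = f (T q.1)) h3'
    have h4 : ∀ᵐ u ∂μ₁, F (T u) = f (T u) := by
      filter_upwards [h3] with u hu
      show essSup (fun v => F' (θ (T u) v)) μ₁ = f (T u)
      rw [essSup_congr_ae (hu : (fun v => F' (θ (T u) v)) =ᵐ[μ₁] fun _ => f (T u)), essSup_const _ hμ₁0]
    rw [← hTmp.map_eq]
    exact (ae_map_iff hTmp.measurable.aemeasurable (measurableSet_eq_fun hFm hf)).2 h4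
  · -- MTP₂ at every pair
    intro x y
    refine ENNReal.mul_le_of_forall_lt fun a ha b hb => ?_
    set A := {u | a < F' (θ x u)} with hA
    set B := {v | b < F' (θ y v)} with hB
    have hA0 : μ₁ A ≠ 0 := measure_ne_zero_of_lt_essSup' ha
    have hB0 : μ₁ B ≠ 0 := measure_ne_zero_of_lt_essSup' hb
    have hAB : (μ₁.prod μ₁) (A ×ˢ B) ≠ 0 := by rw [Measure.prod_prod]; exact mul_ne_zero hA0 hB0
    -- the null sets above the essential suprema at the meet and the join
    set N₃ := {w | F (x ⊓ y) < F' (θ (x ⊓ y) w)} ∩ U with hN₃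
    set N₄ := {w | F (x ⊔ y) < F' (θ (x ⊔ y) w)} ∩ U with hN₄
    have hN₃0 : volume N₃ = 0 := measure_inter_eq_zero_of_essSup_restrict_le (hF'm.comp (hθm' _)) le_rfl
    have hN₄0 : volume N₄ = 0 := measure_inter_eq_zero_of_essSup_restrict_le (hF'm.comp (hθm' _)) le_rfl
    have hprod : μ₁.prod μ₁ = ((volume : Measure (Fin 2 → ℝ)).prod volume).restrict (U ×ˢ U) := by
      rw [hμ₁, Measure.prod_restrict]
    have good : ∀ᵐ z ∂μ₁.prod μ₁, (z.1 ∈ U ∧ z.2 ∈ U) ∧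
        ∀ S : Finset (Fin 2), S.piecewise z.1 z.2 ∉ N₃ ∧ S.piecewise z.1 z.2 ∉ N₄ := by
      refine haeU2.and ?_
      rw [ae_all_iff]
      intro S
      have h3 : ∀ᵐ z ∂(volume : Measure (Fin 2 → ℝ)).prod volume, S.piecewise z.1 z.2 ∉ N₃ := by
        rw [ae_iff]; simpa only [not_not] using volume_prod_piecewise_mem_null S hN₃0
      have h4 : ∀ᵐ z ∂(volume : Measure (Fin 2 → ℝ)).prod volume, S.piecewise z.1 z.2 ∉ N₄ := by
        rw [ae_iff]; simpa only [not_not] using volume_prod_piecewise_mem_null S hN₄0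
      rw [hprod]
      exact ae_restrict_of_ae (h3.and h4)
    obtain ⟨z, ⟨hzA, hzB⟩, ⟨hz1, hz2⟩, hzS⟩ : ∃ z ∈ A ×ˢ B, (z.1 ∈ U ∧ z.2 ∈ U) ∧
        ∀ S : Finset (Fin 2), S.piecewise z.1 z.2 ∉ N₃ ∧ S.piecewise z.1 z.2 ∉ N₄ := by
      by_contra hne
      push Not at hne
      apply hAB
      refine measure_mono_null (fun z hz => ?_) (ae_iff.1 good)
      intro h
      obtain ⟨S, hS⟩ := hne z hz h.1
      exact (h.2 S).2 (hS (h.2 S).1)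
    have hu : ∀ i, z.1 i ∈ Icc (0 : ℝ) 1 := fun i => Ioo_subset_Icc_self (Set.mem_univ_pi.1 hz1 i)
    have hv : ∀ i, z.2 i ∈ Icc (0 : ℝ) 1 := fun i => Ioo_subset_Icc_self (Set.mem_univ_pi.1 hz2 i)
    -- the two gluings realising the meet and the join
    set S₃ : Finset (Fin 2) := Finset.univ.filter fun i => x i < y i ∨ (x i = y i ∧ z.1 i ≤ z.2 i) with hS₃
    set S₄ : Finset (Fin 2) := Finset.univ.filter fun i => y i < x i ∨ (x i = y i ∧ z.2 i ≤ z.1 i) with hS₄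
    have hinf : θ x z.1 ⊓ θ y z.2 = θ (x ⊓ y) (S₃.piecewise z.1 z.2) :=
      rpit_pi_inf ν x y hu hv S₃ fun i => by simp [hS₃]
    have hsup : θ x z.1 ⊔ θ y z.2 = θ (x ⊔ y) (S₄.piecewise z.1 z.2) :=
      rpit_pi_sup ν x y hu hv S₄ fun i => by simp [hS₄]
    have hpU : ∀ S : Finset (Fin 2), S.piecewise z.1 z.2 ∈ U := fun S => Set.mem_univ_pi.2 fun i => by
      by_cases hi : i ∈ S
      · rw [Finset.piecewise_eq_of_mem _ _ _ hi]; exact Set.mem_univ_pi.1 hz1 i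
      · rw [Finset.piecewise_eq_of_notMem _ _ _ hi]; exact Set.mem_univ_pi.1 hz2 i
    have hg3 : F' (θ (x ⊓ y) (S₃.piecewise z.1 z.2)) ≤ F (x ⊓ y) := by
      by_contra hlt
      exact (hzS S₃).1 ⟨not_le.1 hlt, hpU S₃⟩
    have hg4 : F' (θ (x ⊔ y) (S₄.piecewise z.1 z.2)) ≤ F (x ⊔ y) := by
      by_contra hlt
      exact (hzS S₄).2 ⟨not_le.1 hlt, hpU S₄⟩
    calc a * b ≤ F' (θ x z.1) * F' (θ y z.2) := mul_le_mul' hzA.le hzB.le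
      _ ≤ F' (θ x z.1 ⊓ θ y z.2) * F' (θ x z.1 ⊔ θ y z.2) := hF'mtp _ _
      _ = F' (θ (x ⊓ y) (S₃.piecewise z.1 z.2)) * F' (θ (x ⊔ y) (S₄.piecewise z.1 z.2)) := by rw [hinf, hsup]
      _ ≤ F (x ⊓ y) * F (x ⊔ y) := mul_le_mul' hg3 hg4



/-- **Densities with zeros, product of σ-finite measures with atoms.**  For σ-finite `ρ₀, ρ₁` on `ℝ` (atoms allowed)
and `π = ρ₀ ⊗ ρ₁`: every measurable, `π`-a.e. finite `f : ℝ² → [0,∞]`, TP₂ on `π ⊗ π`-almost every pair, has a Borel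
version `F = f` `π`-a.e. with `F(x) F(y) ≤ F(x ∧ y) F(x ∨ y)` for ALL `x, y`. [this work] -/
theorem exists_measurable_tp2_version_of_ae_zeros_pi' (ρ : Fin 2 → Measure ℝ) [∀ i, SigmaFinite (ρ i)]
    (f : (Fin 2 → ℝ) → ℝ≥0∞) (hf : Measurable f) (hfin : ∀ᵐ x ∂Measure.pi ρ, f x ≠ ∞)
    (hMTP : ∀ᵐ p ∂(Measure.pi ρ).prod (Measure.pi ρ), f p.1 * f p.2 ≤ f (p.1 ⊓ p.2) * f (p.1 ⊔ p.2)) :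
    ∃ F : (Fin 2 → ℝ) → ℝ≥0∞, Measurable F ∧ F =ᵐ[Measure.pi ρ] f ∧ ∀ x y, F x * F y ≤ F (x ⊓ y) * F (x ⊔ y) := by
  by_cases h0 : ∃ i, ρ i = 0
  · obtain ⟨i, hi⟩ := h0
    have hpi : Measure.pi ρ = 0 := by
      rw [← Measure.measure_univ_eq_zero, Measure.pi_univ]
      exact Finset.prod_eq_zero (Finset.mem_univ i) (by rw [hi]; rfl)
    refine ⟨fun _ => 0, measurable_const, ?_, fun _ _ => by simp⟩
    rw [hpi]; exact ae_zero.le (by simp)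
  push Not at h0
  haveI : ∀ i, NeZero (ρ i) := fun i => ⟨h0 i⟩
  set ν : Fin 2 → Measure ℝ := fun i => (ρ i).toFinite with hν
  haveI : ∀ i, IsProbabilityMeasure (ν i) := fun i => by rw [hν]; infer_instance
  have hρν : Measure.pi ρ ≪ Measure.pi ν := pi_absolutelyContinuous_pi_toFinite ρ
  have hνρ : Measure.pi ν ≪ Measure.pi ρ := pi_toFinite_absolutelyContinuous_pi ρ
  obtain ⟨F, hFm, hFf, hFtp⟩ := exists_measurable_tp2_version_of_ae_zeros_pi_prob ν f hf (hνρ.ae_le hfin)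
    ((hνρ.prod hνρ).ae_le hMTP)
  exact ⟨F, hFm, hρν.ae_le hFf, hFtp⟩

end Plane

end Summit.CriticalPhenomena.PercolationContinuityZ3.Theorems.SahiAEFourFunctions
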